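import Mathlib
import Summits.Ventures.HodgeRepro.Tier4.Target
import Summits.Ventures.HodgeRepro.Tier4.Line3.Defs
import Summits.Ventures.HodgeRepro.Tier4.Line3.Majorant
import Summits.Ventures.HodgeRepro.Tier4.Line3.OffMainOrbit
import Summits.Ventures.HodgeRepro.Tier4.Line3.SylvesterTransfer

/-!
# Tier4/Line3/ClassBoundLemmas — the torus bookkeeping of the class bound (rung for L3.4 / L3.5)

Blind re-derivation cell `pub-hodge-repro`, Tier 4 «PROVE THE STEP» (README §9–§10), LINE L3, seat t4-L2-p3 on L3.5
`term_dominated` (lead S12234).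

The summand of the quadruple series is evaluated at the CHOSEN representative `rep w = (Quot.out (w j))_j` of a line
tuple, while `Loc.supp` places SOME representative `x` (with `lines x = w`) in the congruence ball.  The two differ by
unit scalars `t_j ∈ E′^1` (`rep_eq_smul_of_lines_eq`: `rep w j = t_j • x j`, `c′ t_j · t_j = 1`), which every quantity of
the class bound ignores:

* `norm_emb_eq_one_of_norm_one` — `‖σ t‖ = 1` at every complex embedding `σ` for `c′ t · t = 1` (CM conjugation);
* `ballCoord_smul_tau` / `norm_ballCoord_smul_tau_eq` / `sum_norm_ballCoord_smul_tau_eq` — the ball coordinates scale by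
  `τ₀ t`, a unit, so their norms are unchanged; `maj_ballCoord_smul_tau` — the majorant is unchanged (`maj_smul`);
* `sum_norm_emb_smul_eq` — the definite sizes `Σ_i ‖σ (x i)‖²` are unchanged;
* `norm_tau_hform_smul_eq` — `‖τ₀ ⟨t • x, t' • x'⟩‖ = ‖τ₀ ⟨x, x'⟩‖`, and the same at every embedding;
* `gaussian_half_small` — R4 with the HALF Gaussians: `R ≤ ‖(y, y')_J‖` gives
  `e^{−(π/2) maj y z} · e^{−(π/2) maj y' z} ≤ e^{−πR}` (directly from R3 `rung_hform_le_maj`).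

Nothing here asserts anything about the truth of (P); HC_CM is NOT proved by anyone in this repository.
-/

set_option autoImplicit false

noncomputable section

namespace Summit.Ventures.HodgeRepro.Tier4.Line3

open Matrix NumberField
open scoped ComplexConjugate

/-- **R4 with half Gaussians.** `R ≤ ‖(y, y')_J‖` gives `e^{−(π/2) maj y z} e^{−(π/2) maj y' z} ≤ e^{−πR}` on the ball. -/
theorem gaussian_half_small (y y' : Fin 3 → ℂ) (z : Fin 2 → ℂ) (hz : z ∈ ball) (R : ℝ)
    (hR : R ≤ ‖star y ⬝ᵥ (J *ᵥ y')‖) :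
    Real.exp (-(Real.pi / 2) * maj y z) * Real.exp (-(Real.pi / 2) * maj y' z) ≤ Real.exp (-(Real.pi * R)) := by
  rw [← Real.exp_add]
  apply Real.exp_le_exp.mpr
  have h := rung_hform_le_maj y y' z hz
  have hpi : 0 < Real.pi := Real.pi_pos
  nlinarith

namespace T4Data

variable (X : T4Data)

/-- `‖σ t‖ = 1` at every complex embedding for a norm-one scalar `c′ t · t = 1`. -/
theorem norm_emb_eq_one_of_norm_one (σ : X.E →+* ℂ) {t : X.E} (ht : X.c t * t = 1) : ‖σ t‖ = 1 := by
  have h : σ (X.c t) * σ t = 1 := by rw [← map_mul, ht, map_one]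
  have hconj : σ (X.c t) = conj (σ t) := IsCMField.complexEmbedding_complexConj X.E σ t
  rw [hconj, Complex.conj_mul'] at h
  have h2 : (‖σ t‖ ^ 2 : ℝ) = 1 := by exact_mod_cast h
  nlinarith [norm_nonneg (σ t), sq_nonneg (‖σ t‖ - 1)]

/-- The ball coordinates are `τ₀`-linear in the scalar. -/
theorem ballCoord_smul_tau (t : X.E) (x : Fin 3 → X.E) : X.ballCoord (t • x) = X.τ₀ t • X.ballCoord x := by
  unfold ballCoord
  rw [← Matrix.mulVec_smul]
  congr 1
  funext i
  simp [map_mul]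

/-- `Σ_i ‖y (t • x) i‖ = Σ_i ‖y x i‖` for a norm-one scalar. -/
theorem sum_norm_ballCoord_smul_tau_eq {t : X.E} (ht : X.c t * t = 1) (x : Fin 3 → X.E) :
    ∑ i, ‖X.ballCoord (t • x) i‖ = ∑ i, ‖X.ballCoord x i‖ := by
  rw [X.ballCoord_smul_tau]
  simp [X.norm_emb_eq_one_of_norm_one X.τ₀ ht]

/-- `‖y (t • x)‖ = ‖y x‖` for a norm-one scalar (sup norm on `Fin 3 → ℂ`). -/
theorem norm_ballCoord_smul_tau_eq {t : X.E} (ht : X.c t * t = 1) (x : Fin 3 → X.E) :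
    ‖X.ballCoord (t • x)‖ = ‖X.ballCoord x‖ := by
  rw [X.ballCoord_smul_tau, norm_smul, X.norm_emb_eq_one_of_norm_one X.τ₀ ht, one_mul]

/-- The majorant of the ball coordinates is unchanged by a norm-one scalar. -/
theorem maj_ballCoord_smul_tau {t : X.E} (ht : X.c t * t = 1) (x : Fin 3 → X.E) (z : Fin 2 → ℂ) :
    maj (X.ballCoord (t • x)) z = maj (X.ballCoord x) z := by
  rw [X.ballCoord_smul_tau]
  exact maj_smul _ (X.norm_emb_eq_one_of_norm_one X.τ₀ ht) _ _

/-- The definite sizes are unchanged by a norm-one scalar. -/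
theorem sum_norm_emb_smul_eq (σ : X.E →+* ℂ) {t : X.E} (ht : X.c t * t = 1) (x : Fin 3 → X.E) :
    ∑ i, ‖σ ((t • x) i)‖ ^ 2 = ∑ i, ‖σ (x i)‖ ^ 2 := by
  simp [Pi.smul_apply, smul_eq_mul, map_mul, X.norm_emb_eq_one_of_norm_one σ ht]

/-- The size of a Gram entry at any embedding is unchanged by norm-one scalars on the two vectors. -/
theorem norm_emb_hform_smul_eq (σ : X.E →+* ℂ) {t t' : X.E} (ht : X.c t * t = 1) (ht' : X.c t' * t' = 1)
    (x x' : Fin 3 → X.E) :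
    ‖σ (hform X.c X.H (t • x) (t' • x'))‖ = ‖σ (hform X.c X.H x x')‖ := by
  rw [hform_smul_left, hform_smul_right, map_mul, map_mul, norm_mul, norm_mul,
    X.norm_emb_eq_one_of_norm_one σ ht', one_mul]
  have hc : X.c (X.c t) * X.c t = 1 := by rw [X.c_c, mul_comm]; exact ht
  rw [X.norm_emb_eq_one_of_norm_one σ hc, one_mul]

/-- **The chosen representative of a line tuple is a unit-scalar multiple of any representative.** -/
theorem rep_eq_smul_of_lines_eq {w : X.LineTuple} {x : X.Tuple} (hx : X.lines x = w) (j : Fin 4) :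
    ∃ t : X.E, X.c t * t = 1 ∧ X.rep w j = t • x j := by
  obtain ⟨t, ht, hout⟩ := X.lineStep_out (x j)
  refine ⟨t, ht, ?_⟩
  rw [← hx]
  exact hout

end T4Data

end Summit.Ventures.HodgeRepro.Tier4.Line3

end
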